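import Mathlib
import HarnessLib
import HarnessLib.Audit
import Summits.AnomalousDissipation.Statement
import Literature.Analysis.FluidPDE.LerayHopf
import Literature.Analysis.FluidPDE.ZerothLaw
import Summits.AnomalousDissipation.AnomalousDissipation.Theses.RootDecompCycle1
import Summits.AnomalousDissipation.AnomalousDissipation.Theses.RootDecompCycle2A
import Summits.AnomalousDissipation.AnomalousDissipation.Theorems.TaylorGreenLoudGalerkinStates.Negative.Anatomy
import HarnessLib.Audit.Status.Attr

/-!
Route: StrainDichotomy

# Route StrainDichotomy — Taylor–Green Onsager window from the skeleton variance law and a strain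
dichotomy whose tame branch is a theorem

decomp-ad RESIDUAL DECOMPOSITION, generation 8, lens-2 «structural dichotomy (special vs generic)»
(cell HOME run/shared/lean/pub/decomp-ad; node HOME/decomp-ad-lens-2/StrainDichotomy.lean v3 sha256
3c716ef34762ee1d, `lean check` rc 0 · 0 sorry · 0 warn, 580 lines; card StrainDichotomy_NODE.md;
package split5/ (items_v3.json 379d5709…, BC7 probes 7/7 CLEAN, BC3 birth skeleton
SkeletonVarianceLawTG_birth.lean 632ece1a…); critic decomp-ad-crit-1 CLEARED 2026-08-30T06:51:26Z;
writer paste check g4/SD/SketchSD.lean rc 0 · 0 sorry: every item text ↔ the lens decl / the 2A tree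
item := Iff.rfl ×12, `closes`, `refines : RootDecompCycle2A.OnsagerWindowTG`, `window_of_pieces`,
necessity lemmas). CHILD ROUTE of route-AnomalousDissipation-RootDecompCycle2A refining its layer-2
DECLARED RESIDUAL 26826 `OnsagerWindowTG := SobolevRougheningTG → SpinUpRougheningTG` (D-0019: a
layer-2 node is refined by a child route, never by a third item layer; 2A's operator resplit of
25779 is pending), ROOT FORM. It suffices to show X = SkeletonVarianceLawTG (C₁♯, the skeleton
variance law — THEOREM-GRADE, attackable now) ∧ RoughStrainRougheningTG (C₃♯ := Sob → C₁♯ → P₀ → ¬W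
→ R1, the generic branch — the NEW DECLARED RESIDUAL) ∧ StrainDichotomyWindowTG (C₁♯ → C₃♯ → 26826:
the local assembly of the dichotomy, THEOREM-GRADE — excluded middle on the world proposition W
«quiet ⇒ tame» with the tame branch PROVED in the node file, 0 sorry, from the three textbook
supports P₀ P₁ P₂) on top of 2A's spine shared by signature: 26825 SobolevRougheningTG, 24256
RestMeanCeilingTG, 25780 RougheningRateUpgradeTG (24257 TaylorGreenForceRegularTG is discharged
inside `closes` by the tree theorems `Negative.isSmooth_tgForce / isDivFree_tgForce /
hasZeroMean_tgForce`). Kernel (node file, 0 sorry): `spinUp_of_split5`, `window_of_split5`,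
`window_iff_rough_of_supports : C₁♯ → P₀ → P₁ → P₂ → (26826 ↔ C₃♯)` (one EQUIV),
`tameBranch_of_varianceLaw` (≈175 lines), `not_tame_of_not_spinUp`; writer sketch: `refines (hL hR
hK) : RootDecompCycle2A.OnsagerWindowTG := hK hL hR`, `closes (hS hC hL hR hK hU) :=
RootDecompCycle2A.closes ⟨TG regular⟩ hC (hK hL hR hS) hU`.
Lean: `SobolevRougheningTG → RestMeanCeilingTG → SkeletonVarianceLawTG → RoughStrainRougheningTG →
StrainDichotomyWindowTG → RougheningRateUpgradeTG → _root_.AnomalousDissipation`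
(over Literature.Analysis.FluidPDE.Torus.IsGlobalLerayHopf,
Literature.Analysis.FluidPDE.{meanEnergy, meanDissipation},
Literature.Analysis.FunctionSpaces.Torus.{HasWeakPartialDeriv, eHomSobolevSeminorm}, MemLp / volume
/ lintegral / Filter.limsup / Filter.liminf, fourier, UnitAddTorus,
Summit.AnomalousDissipation.AnomalousDissipation.Theses.RootDecompCycle2A.{SpinUpRougheningTG,
OnsagerWindowTG} — every constant confirmed by elaboration of SketchSD.lean and the native route
check).

## Assembly
Pure logic over RootDecompCycle2A's deciding theorem: `closes (hS : SobolevRougheningTG) (hC :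
RestMeanCeilingTG) (hL : SkeletonVarianceLawTG) (hR : RoughStrainRougheningTG) (hK :
StrainDichotomyWindowTG) (hU : RougheningRateUpgradeTG) : _root_.AnomalousDissipation :=
RootDecompCycle2A.closes (TG force smooth ∧ div-free ∧ mean-zero, by the tree theorems
Negative.isSmooth_tgForce / isDivFree_tgForce / hasZeroMean_tgForce) hC (hK hL hR hS) hU` — the
window applied to Sob gives R1 = 25779, 25780 upgrades R1 to the floor 24255, 2A's closes joins
floor and ceiling at the pinned force. `refines (hL hR hK) : RootDecompCycle2A.OnsagerWindowTG := hK
hL hR`.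

Rationale: WHY THIS LINE. Axis = a STRUCTURAL INVARIANT of the competitor world: the strain-density class of
the loading of the Taylor–Green symmetry skeleton C = ∂([0,½]²×{0}) (4 invariant edges + 4
stagnation corners of every K-symmetric flow) in the QUIET world (bounded Cesàro-mean enstrophy as ν
↓ 0 although the Kelvin torque 2/π is injected around the lattice face every unit of time). The
sharpened pinned-loop lemma (★) |Λ_δ(v)| ≤ C₀δ⁻¹[(Ξ_δ S_δ)^{1/2} + S_δ] (resolved Lamb flux ≡ 0 on
the skeleton; subgrid stress ≤ box VARIANCE of the axial component × odd-Poincaré of the DIAGONAL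
STRAIN) and the loop-tested balance for every T give the VARIANCE LAW C₁♯: c·δ ≤ η·Ξ̲_δ + η⁻¹·Ŝ_δ +
Ŝ_δ + (Bν/δ)·Ẑ_δ^{1/2} for every symmetric Leray–Hopf solution from rest — true in all worlds
(arXiv:physics/0605014 Eyink's loop cascade made component-resolved; doi:10.1007/BF02099744;
DuchonRobert2000; Frisch1995 p.207). The NEW MOVE is the multi-scale variance count: if quiet
symmetric spin-ups have TAME diagonal strain at the skeleton (W: Ŝ_δ ≤ Kδ²), C₁♯ forces an O(1)
variance core at N nested dyadic widths, and the dyadic box-variance CARLESON sum (P₁, fieldwise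
real analysis: Stein1970, FeffermanStein1972) charges N units of enstrophy against a bounded budget
— contradiction: the QUIET-TAME world is EMPTY, proved in the node file
(`tameBranch_of_varianceLaw`, 0 sorry). What is left — the declared residual C₃♯ — is handed the
failure object itself as hypothesis: ¬W = quiet symmetric spin-ups along ν_j ↓ 0 loading the
skeleton with SINGULAR diagonal strain (√r-conical separatrix edges, Hölder-½ corners); its natural
proof is W (a ν-uniform conditional-regularity statement at an invariant line under bounded mean
enstrophy; Kato1984 is the strip analogue). Imported: harmonic-analysis square-function/Carleson
counting (P₁) into the Navier–Stokes loop balance; nothing in the negatives index (13037, 14324,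
0204, 2979, 2984, 2859) has this shape, and no other cell lens uses a strain-class axis (lens-1
scale window / force-class ladder, lens-3 certificates, lens-4 symmetry trimming, lens-5
concentration-compactness, lens-6 designed work).

RANKED CRUXES. #2 SkeletonVarianceLawTG (crux) — C₁♯ SKELETON VARIANCE LAW at the pinned
Taylor–Green force (lens-2 g5 node item, verbatim): ∃ c B δ₁ > 0 such that for every ν > 0, EVERY
K-symmetric global Leray–Hopf solution u from rest at f_TG and every jointly measurable family g of
L²-witnesses of ∇u satisfy, for all 0 < δ ≤ δ₁ and η > 0, c·δ ≤ η·Ξ̲_δ + η⁻¹·Ŝ_δ + Ŝ_δ +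
(Bν/δ)·Ẑ_δ^{1/2} (Ξ̲ = liminf_T Cesàro mean of the δ⁻³-normalised box variance of the axial velocity
along the skeleton lines, Ŝ / Ẑ = limsup means of the diagonal strain / the enstrophy on the
skeleton tube TT_δ, in ℝ≥0∞). THEOREM-GRADE (M–L; XL to formalise), tag WEAKER (true in all worlds),
ATTACKABLE NOW: BC3 birth skeleton HOME/decomp-ad-lens-2/split5/SkeletonVarianceLawTG_birth.lean
632ece1a… (stubs stub_loopLemma [HEART, L] / stub_testedBalancePerT [M–L]; Cesàro extraction and the
composition SkeletonVarianceLawTG_of PROVED; sorries = stubs = 2; stub probes CLEAN 2/2 each);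
load-bearing in BOTH branches. [difficulty: L] (why it might fail: Only via typing: liminf (Ξ) /
limsup (S, Z) placement (the per-T tested balance holds for every T, so one liminf is legitimate),
Bochner box averages, B absorbing ‖∇w_δ‖₂ ≍ δ⁻²; the mathematics ((★) + tested balance) is
elementary but XL to formalise.) [arXiv:physics/0605014, doi:10.1007/BF02099744, DuchonRobert2000,
ChildressKerswellGilbert2001, Frisch1995, RobinsonRodrigoSadowski2016]
#3 RoughStrainRougheningTG (crux) — C₃♯ GENERIC BRANCH = the NEW DECLARED RESIDUAL (refines 2A:26826
and 25779 by the strain axis): SobolevRougheningTG → SkeletonVarianceLawTG → P₀ (symmetric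
Leray–Hopf existence with witnesses, inlined) → ¬W → RootDecompCycle2A.SpinUpRougheningTG, where ¬W
(W = SkeletonStrainTameTG «quiet ⇒ tame», inlined; filed as an aside after birth) = «QUIET SINGULAR
WORLDS EXIST along a sequence»: some level L such that for all K δ₀ ν₀ there are ν < ν₀ and a
K-symmetric Leray–Hopf spin-up from rest, quiet at level L (total mean witness enstrophy ≤ L),
loading the skeleton tube with Ŝ_δ > Kδ² at some δ ≤ δ₀ — literally the failure object of 26826.
KERNEL-WEAKER than 26826 (`roughBranch_of_window`, writer sketch `rough_of_window`) and EXACT given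
C₁♯ + P₀ P₁ P₂ (`window_iff_rough_of_supports`); UNDECIDED, BARRIER-adjacent, IDEA-NEEDED (natural
proof = prove W), INSTRUMENTABLE (census T-KR6 Q1: m(S_δ)/δ² at δ = 2⁻⁴ vs ν at bounded total
enstrophy — W predicts ν-flat, ¬W growth ≳ ×2 per halving). [deps: SkeletonVarianceLawTG,
SobolevRougheningTG] [difficulty: open-problem] (why it might fail: Exactly if a QUIET SINGULAR
world — bounded tube enstrophy with density ≍ dist(·,skeleton)⁻¹ (√r-conical separatrix edges or
Hölder-½ stagnation corners) — is realised by the Cesàro statistics of K-symmetric Leray–Hopf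
spin-ups uniformly in ν; no known tool excludes it.) [Kato1984, ChildressKerswellGilbert2001,
MajdaBertozzi2002, run/shared/lean/pub/decomp-ad/census/TKR-v1.md,
run/shared/lean/pub/decomp-ad/census/TR2P-v1.md]
#4 SobolevRougheningTG (crux) — SHARED BY SIGNATURE with route RootDecompCycle2A item 26825 (split
child of 25779; text verbatim): Ḣ^s-roughening of the Taylor–Green spin-up for every s > 3/2 — for
every M and all small ν some global Leray–Hopf solution from rest at f_TG has limsup-mean
Ḣ^s-seminorm² ≥ M. THEOREM-GRADE, ATTACKABLE NOW (lines S1–S5 registered on 26825 by 2A; not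
re-staffed here); antecedent of C₃♯ and of 26826. [difficulty: L] (why it might fail: Only if the
pinned-loop commutator estimate S3 (shift gain + edge trace in H^s, s > 3/2) or K-symmetric
Leray–Hopf existence from rest failed — both standard; the risk is size (L–XL), not truth.)
[doi:10.1016/j.crhy.2006.01.008, arXiv:physics/0605014, doi:10.1007/BF02099744,
doi:10.1088/1361-6544/ab2f42, arXiv:1710.05205]
#5 RestMeanCeilingTG (crux) — SHARED BY SIGNATURE with RootDecompCycle2A item 24256 (crux 4 of 2A;
text verbatim; untouched by this node): SPIN-UP CEILING AT f_TG — there are E and ν₀ > 0 such that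
for every ν ∈ (0, ν₀) EVERY global Leray–Hopf solution from rest driven by f_TG has meanEnergy u ≤
E. [difficulty: open-problem] (why it might fail: hard-core energy axis: the from-rest TG energy may
grow like ν^(-a) as ν → 0 (condensate-type pile-up at the forcing scale); no ν-uniform ceiling
mechanism at a pumped 3-D force is known.) [DoeringFoias2002, doi:10.1017/s0022112083001159,
ConstantinTarfuleaVicol2013]
#6 RougheningRateUpgradeTG (crux) — SHARED BY SIGNATURE with RootDecompCycle2A item 25780 (crux 3,
2A's other DECLARED RESIDUAL; filed FULLY INLINED: 25779-text → 24255-text; by-name form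
SpinUpRougheningTG → RestMeanFloorTG; untouched by this node): ROUGHENING FORCES THE KOLMOGOROV RATE
AT f_TG — unbounded mean enstrophy of the spin-up ⇒ a uniform dissipation floor ε > 0. [difficulty:
open-problem] (why it might fail: rate selection: intermediate roughening ⟨‖∇u‖²⟩ ≍ ν^(-a), a < 1
(swept shears with drift ν^(1/4): a = ½; 2-D families) may be what the TG spin-up does; nothing
known pins a = 1 at f_TG.) [Frisch1995, DoeringFoias2002, doi:10.1017/s0022112083001159]
#9 StrainDichotomyWindowTG (support) — THE DICHOTOMY'S LOCAL ASSEMBLY (binder of `closes`; = lens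
kernel `window_of_split5` with the toolkit as separately filed supports): SkeletonVarianceLawTG →
RoughStrainRougheningTG → RootDecompCycle2A.OnsagerWindowTG. THEOREM-GRADE (L in Lean), ATTACKABLE
NOW: by excluded middle on W it follows by pure logic (writer sketch `window_of_pieces`, 0 sorry)
from the three supports P₀ SymmetricLerayHopfTG (M), P₁ SkeletonCarlesonTG (M on paper / L in Lean),
P₂ WitnessDissipationBridgeTG (S–M) and the SPECIAL BRANCH TameStrainRougheningTG := C₁♯ → P₀ → P₁ →
P₂ → W → R1, PROVED in the node file (`tameStrainRoughening_holds`, ≈175 lines, 0 sorry; port to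
Theorems/) — all four filed on this route after birth (supports rank 9; W and the BC5 plan-only rung
SteadyVarianceLawTG as asides). KERNEL-WEAKER than 26826 (writer sketch `window_of_window`). [deps:
SkeletonVarianceLawTG, RoughStrainRougheningTG] [difficulty: L] (why it might fail: It cannot in
substance: excluded middle on W + the node's proved tame branch; the three supports are existence /
fieldwise real analysis / Plancherel bookkeeping (sizes M, M–L, S–M).)
[run/shared/lean/pub/decomp-ad/decomp-ad-lens-2/StrainDichotomy.lean, Stein1970, FeffermanStein1972,
Galdi2000, Temam1977]

TWO-LAYER PLAN. StrainDichotomyWindowTG ⇐ SymmetricLerayHopfTG → SkeletonCarlesonTG →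
WitnessDissipationBridgeTG → TameStrainRougheningTG → StrainDichotomyWindowTG (glue = writer sketch
`window_of_pieces`; the four pieces are filed as supports at birth+1, so the split is only
bookkeeping once they land). RoughStrainRougheningTG ⇐ W (SkeletonStrainTameTG proved outright) is
the natural one-child refinement; finer cuts recorded by the lens (edge-conical vs corner-singular
loading; pointwise-in-ν scale-limited tameness) are NOT filed.

KILL CRITERIA. C₃♯ dies (and with it 26826, 25779 and 2A's line at the pin) if census T-KR6 Q1 shows
m(S_δ)/δ² at δ = 2⁻⁴ growing ≳ ×2 per halving of ν AT BOUNDED total enstrophy on the symmetric DNS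
spin-up (a quiet singular world realised) — then the route closes refuted:RoughStrainRougheningTG
unless R1 is observed directly (enstrophy unbounded), in which case only the strain axis was wrong.
C₁♯ can only fail by a typing slip (liminf/limsup placement); a refutation of C₁♯ AS TYPED forces a
restatement, not a pivot. If 2A:26826 or 25779 is proved directly elsewhere the route is superseded
(close --reason superseded --by route-AnomalousDissipation-RootDecompCycle2A); if 24256 or 25780 is
refuted, 2A and this child die together.

NOT DECOMPOSED YET. C₃♯ (the residual) is ONE statement: its hypothesis ¬W already names the failure
object; splitting it by geometry (edges vs corners) or by scale-limited tameness is deferred until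
T-KR6 data or a prover's obstruction says which. The toolkit P₀/P₁/P₂ and the proved tame branch are
filed as rank-9 supports after birth (outside the binders, inside StrainDichotomyWindowTG's proof),
not as cruxes; W and the BC5 plan-only rung SteadyVarianceLawTG are asides.

CHEAPEST FALSIFIER. Census T-KR6 Q1 (folds into the queued single-snapshot T-KR3/4/5 job under the
operator FOREST CHECK LEVER): m(S_δ)/δ² at δ = 2⁻⁴ versus ν ∈ {1/16, 1/32, 1/64, 1/128} on the
K-symmetric Taylor–Green DNS spin-up, read only where the total enstrophy is ν-flat — W predicts
ν-flat, ¬W predicts growth ≳ ×2 per halving; Q2 (law sanity) ρ(δ) = (2/π)δ/[(Ξ_δS_δ)^(1/2) + S_δ] =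
O(1), ν-flat for δ ≥ 2⁻⁴; Q4 (Carleson sanity) Σ_{k=3..6} Ξ_{2⁻ᵏ}/Z_{2⁻³} ≤ 5. Not runnable by this
seat (kit_allowed false); REQUEST on the cell census bus 05:47:10Z.

NUMBERS. Kelvin torque of f_TG around the lattice face: 2/π per unit time (node §engine; ∫⟪f_TG,
w_δ⟫ → 4/π for the full loop current, 2A:26825 S2). Carleson constant: Σ_{k<K} Ξ_{δ₀/2^k} ≤
C·(Z_{δ₀} + Σ S) with C absolute (P₁); tame-branch count: N > 2CM/c₂ dyadic scales with c₂ =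
c²/(16K′) (node theorem tameBranch_of_varianceLaw). Census TKR-v1 T-KR2 (2A): N_{3/2} ∝
r^(−(1.6…1.9)), N_2 ∝ r^(−(2.3…2.7)) over r = ν/ν_ref = 1/32…1/512.

DEFINITION REQUESTS. None: every functional (box variance Ξ, diagonal strain S, tube enstrophy Z,
Cesàro liminf/limsup means) is spelled out inline over Mathlib +
Literature.Analysis.FunctionSpaces.Torus.HasWeakPartialDeriv; SteadyVarianceLawTG (aside, BC5
plan-only rung) uses Literature.Analysis.FunctionSpaces.Torus.IsClassicalNSSolutionOn / partialDeriv
(in tree).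

Novelty: Searches (2026-08-30, lens-2 g5 05:1x–05:3xZ, corpus fts+vec and galaxy, recorded in
StrainDichotomy_NODE.md §Why novel; writer re-checked the tree with `rg -n "Carleson|box
variance|StrainTame|VarianceLaw" lean/Summits/AnomalousDissipation lean/Literature` → only this
node's names): `lit search --hybrid "loop cascade Kelvin theorem Navier-Stokes dissipation"` →
[corpus: paper:arxiv-physics_0605014 p.5–6], [corpus: paper:arxiv-physics_0212057 p.9] (Eyink loop
cascade, scalar loop flux, no component resolution); `lit search "Taylor-Green vortex dissipation"`
→ [corpus: Frisch1995 p.207] (TG numerics); `lit search "strain stagnation point vorticity"` →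
[corpus: MajdaBertozzi2002 p.166/242]; `lit galaxy search "Childress|separatrix boundary
layer|cellular flow boundary layer" --star all` → junk / no statement; `lit search "Carleson measure
enstrophy lower bound"`, `lit galaxy search "Carleson|square function enstrophy" --star all` → no
hits; Kato1984 (strip criterion) as the structural analogue; ChildressKerswellGilbert2001 /
DoeringFoias2002 (upper bounds only).
Nearest prior art found: arXiv:physics/0605014 (Eyink, loop/Kelvin-theorem cascade heuristics:
scalar loop flux, no closure); Kato1984 (dissipation in a ν-strip ⇔ anomaly — an equivalence in the
boundary setting, here strain in a δ-tube ⇔ roughening); in the cell: 2A's own 27646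
SkeletonEnstrophyLawTG (g4, this lineage: ONE-scale tube-enstrophy law Z_δ ≥ cδ, no contradiction
with bounded enstrophy) and lens-1 g3 Onsager  [refs: physics/0605014, paper:arxiv-physics_0605014, paper:arxiv-physics_0212057, Frisch1995, MajdaBertozzi2002, Kato1984, ChildressKerswellGilbert2001, DoeringFoias2002]

Barriers (technique_class: loop balance, variance Carleson count, dichotomy): - technique_class: loop-tested energy balance, multi-scale variance Carleson count, structural
dichotomy (special branch proved / generic branch residual)
- Literature.Barriers.AnomalousDissipation.Cheskidov2023_thm13_not_forceRobustNoAnomaly: OUTSIDE —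
every statement here is pinned to ONE force f_TG and quantifies over its symmetric Leray–Hopf
solutions; no estimate uniform in the force is claimed (tree ForceRobustEstimates.lean does not
quantify over loop functionals of a fixed force) [tree:
Literature/Barriers/AnomalousDissipation/ForceRobustEstimates.lean].
- Literature.Barriers.AnomalousDissipation.AlexakisDoering2006_energyDissipationBound: consistent —
it is an UPPER bound on dissipation at bounded energy; C₁♯/C₃♯ are lower-bound / roughening
statements at the pin and the ceiling 24256 is imported from 2A unchanged [tree:
TwoDimensionalEnergyDissipation.lean irrelevant: the TG spin-up class is genuinely 3-D,
K-symmetric].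
- Literature.Barriers.AnomalousDissipation.Marchioro1986_globalAttraction: does not bite — f_TG is
not a gravest-mode (single lowest shell, 2-D) force with a globally attracting laminar state; the
shell |k|² = 3 Taylor–Green force is exactly the case Marchioro's theorem excludes, and R1's failure
would need a quiet attracting state whose existence at small ν is the open question, not a theorem.
- Onsager/CET threshold (not catalogued as a barrier file; Literature CET facts): irrelevant by
design — R1 needs only UNBOUNDED ENSTROPHY, and the failure ob

sub-problem: AnomalousDissipation · status: draft · opened planner-decomp-ad-writer-1-g4-0 2026-08-30T07:06:42Z · rev 5 · ledger route-AnomalousDissipation-StrainDichotomy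
GENERATED by the gate from the ledger (D-0016/17). Provers cite these decls: `theorem foo : Summit.AnomalousDissipation.AnomalousDissipation.Theses.StrainDichotomy.<Decl> := …` in Summits/AnomalousDissipation/AnomalousDissipation/Theorems/<Name>.lean.
-/

namespace Summit.AnomalousDissipation.AnomalousDissipation.Theses.StrainDichotomy

open scoped BigOperators Topology Manifold Classical MeasureTheory ProbabilityTheory Matrix InnerProductSpace ComplexConjugate ContinuousMap
open Filter Set Function TopologicalSpace MeasureTheory

attribute [summit_statement] _root_.AnomalousDissipation

open Literature.Turb

/-- item stmt-AnomalousDissipation-29897 · crux · rank 2 · open · by planner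
why it might fail: Only via typing: liminf (Ξ) / limsup (S, Z) placement (the per-T tested balance holds for every T, so one liminf is legitimate), Bochner box averages, B absorbing ‖∇w_δ‖₂ ≍ δ⁻²; the mathematics ((★) + tested balance) is elementary but XL to formalise.
sources: arXiv:physics/0605014, doi:10.1007/BF02099744, DuchonRobert2000, ChildressKerswellGilbert2001, Frisch1995, RobinsonRodrigoSadowski2016
[crux] C₁♯ SKELETON VARIANCE LAW at the pinned Taylor–Green force (lens-2 g5 node item, verbatim): ∃
c B δ₁ > 0 such that for every ν > 0, EVERY K-symmetric global Leray–Hopf solution u from rest at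
f_TG and every jointly measurable family g of L²-witnesses of ∇u satisfy, for all 0 < δ ≤ δ₁ and η >
0, c·δ ≤ η·Ξ̲_δ + η⁻¹·Ŝ_δ + Ŝ_δ + (Bν/δ)·Ẑ_δ^{1/2} (Ξ̲ = liminf_T Cesàro mean of the δ⁻³-normalised
box variance of the axial velocity along the skeleton lines, Ŝ / Ẑ = limsup means of the diagonal
strain / the enstrophy on the skeleton tube TT_δ, in ℝ≥0∞). THEOREM-GRADE (M–L; XL to formalise),
tag WEAKER (true in all worlds), ATTACKABLE NOW: BC3 birth skeleton
HOME/decomp-ad-lens-2/split5/SkeletonVarianceLawTG_birth.lean 632ece1a… (stubs stub_loopLemma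
[HEART, L] / stub_testedBalancePerT [M–L]; Cesàro extraction and the composition
SkeletonVarianceLawTG_of PROVED; sorries = stubs = 2; stub probes CLEAN 2/2 each); load-bearing in
BOTH branches. [difficulty: L] -/
@[route_item "route-AnomalousDissipation-StrainDichotomy", crux]
def SkeletonVarianceLawTG : Prop :=
  ∀ f : UnitAddTorus (Fin 3) → EuclideanSpace ℝ (Fin 3), f = (fun x => !₂[(fourier 1 (x 0) : ℂ).im * (fourier 1 (x 1) : ℂ).re * (fourier 1 (x 2) : ℂ).re, -((fourier 1 (x 0) : ℂ).re * (fourier 1 (x 1) : ℂ).im * (fourier 1 (x 2) : ℂ).re), (0 : ℝ)]) → ∃ c B δ₁ : ℝ, 0 < c ∧ 0 < B ∧ 0 < δ₁ ∧ ∀ ν : ℝ, 0 < ν → ∀ u : ℝ → UnitAddTorus (Fin 3) → EuclideanSpace ℝ (Fin 3), Literature.Analysis.FluidPDE.Torus.IsGlobalLerayHopf ν (fun _ => f) 0 u → (∀ (t : ℝ) (i j : Fin 3) (x : UnitAddTorus (Fin 3)), u t (Function.update x i (-x i)) j = if j = i then -(u t x j) else u t x j) → ∀ g : ℝ → Fin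 3 → UnitAddTorus (Fin 3) → EuclideanSpace ℝ (Fin 3), (∀ j : Fin 3, Measurable (Function.uncurry fun t x => g t j x)) → (∀ᵐ t : ℝ, 0 < t → ∀ j : Fin 3, MemLp (g t j) 2 volume ∧ Literature.Analysis.FunctionSpaces.Torus.HasWeakPartialDeriv j (u t) (g t j)) → ∀ δ : ℝ, 0 < δ → δ ≤ δ₁ → ∀ η : ℝ, 0 < η → ENNReal.ofReal (c * δ) ≤ ENNReal.ofReal η * Filter.liminf (fun T : ℝ => ((ENNReal.ofReal T)⁻¹ * ∫⁻ t in Set.Ioc (0 : ℝ) T, (ENNReal.ofReal (1 / δ ^ 3) * ∫⁻ s in Set.Ioc (0 : ℝ) 1, ((∫⁻ x in {x : UnitAddTorus (Fin 3) | ‖x 0 - ((s : ℝ) : UnitAddCircle)‖ < δ ∧ ‖x 1‖ < δ ∧ ‖x 2‖ < δ}, ‖u t x 0 - (8 * δ ^ 3)⁻¹ * ∫ y in {x : UnitAddTorus (Fin 3) | ‖x 0 - ((s : ℝ) : UnitAddCircle)‖ < δ ∧ ‖x 1‖ < δ ∧ ‖x 2‖ < δ}, u t y 0‖ₑ ^ 2)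 + (∫⁻ x in {x : UnitAddTorus (Fin 3) | ‖x 0 - ((s : ℝ) : UnitAddCircle)‖ < δ ∧ ‖x 1 - ((1 / 2 : ℝ) : UnitAddCircle)‖ < δ ∧ ‖x 2‖ < δ}, ‖u t x 0 - (8 * δ ^ 3)⁻¹ * ∫ y in {x : UnitAddTorus (Fin 3) | ‖x 0 - ((s : ℝ) : UnitAddCircle)‖ < δ ∧ ‖x 1 - ((1 / 2 : ℝ) : UnitAddCircle)‖ < δ ∧ ‖x 2‖ < δ}, u t y 0‖ₑ ^ 2) + (∫⁻ x in {x : UnitAddTorus (Fin 3) | ‖x 0‖ < δ ∧ ‖x 1 - ((s : ℝ) : UnitAddCircle)‖ < δ ∧ ‖x 2‖ < δ}, ‖u t x 1 - (8 * δ ^ 3)⁻¹ * ∫ y in {x : UnitAddTorus (Fin 3) | ‖x 0‖ < δ ∧ ‖x 1 - ((s : ℝ) : UnitAddCircle)‖ < δ ∧ ‖x 2‖ < δ}, u t y 1‖ₑ ^ 2) + (∫⁻ x in {x : UnitAddTorus (Fin 3) | ‖x 0 - ((1 / 2 : ℝ) : UnitAddCircle)‖ < δ ∧ ‖x 1 -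 ((s : ℝ) : UnitAddCircle)‖ < δ ∧ ‖x 2‖ < δ}, ‖u t x 1 - (8 * δ ^ 3)⁻¹ * ∫ y in {x : UnitAddTorus (Fin 3) | ‖x 0 - ((1 / 2 : ℝ) : UnitAddCircle)‖ < δ ∧ ‖x 1 - ((s : ℝ) : UnitAddCircle)‖ < δ ∧ ‖x 2‖ < δ}, u t y 1‖ₑ ^ 2))))) Filter.atTop + (ENNReal.ofReal η)⁻¹ * Filter.limsup (fun T : ℝ => ((ENNReal.ofReal T)⁻¹ * ∫⁻ t in Set.Ioc (0 : ℝ) T, (∫⁻ x in {x : UnitAddTorus (Fin 3) | (‖x 1‖ < δ ∨ ‖x 1 - ((1 / 2 : ℝ) : UnitAddCircle)‖ < δ ∨ ‖x 0‖ < δ ∨ ‖x 0 - ((1 / 2 : ℝ) : UnitAddCircle)‖ < δ) ∧ ‖x 2‖ < δ}, ∑ i : Fin 3, ‖g t i x i‖ₑ ^ 2))) Filter.atTop + Filter.limsup (fun T : ℝ => ((ENNReal.ofReal T)⁻¹ * ∫⁻ t in Set.Ioc (0 : ℝ) T, (∫⁻ x in {x : UnitAddTorus (Fin 3) | (‖x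 1‖ < δ ∨ ‖x 1 - ((1 / 2 : ℝ) : UnitAddCircle)‖ < δ ∨ ‖x 0‖ < δ ∨ ‖x 0 - ((1 / 2 : ℝ) : UnitAddCircle)‖ < δ) ∧ ‖x 2‖ < δ}, ∑ i : Fin 3, ‖g t i x i‖ₑ ^ 2))) Filter.atTop + ENNReal.ofReal (B * ν / δ) * Filter.limsup (fun T : ℝ => ((ENNReal.ofReal T)⁻¹ * ∫⁻ t in Set.Ioc (0 : ℝ) T, (∫⁻ x in {x : UnitAddTorus (Fin 3) | (‖x 1‖ < δ ∨ ‖x 1 - ((1 / 2 : ℝ) : UnitAddCircle)‖ < δ ∨ ‖x 0‖ < δ ∨ ‖x 0 - ((1 / 2 : ℝ) : UnitAddCircle)‖ < δ) ∧ ‖x 2‖ < δ}, ∑ j : Fin 3, ‖g t j x‖ₑ ^ 2))) Filter.atTop ^ (1 / 2 : ℝ)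

/-- item stmt-AnomalousDissipation-26825 · crux · rank 4 · open · by planner
why it might fail: Only if the pinned-loop commutator estimate S3 (shift gain + edge trace in H^s, s > 3/2) or K-symmetric Leray–Hopf existence from rest failed — both standard; the risk is size (L–XL), not truth.
sources: doi:10.1016/j.crhy.2006.01.008, arXiv:physics/0605014, doi:10.1007/BF02099744, doi:10.1088/1361-6544/ab2f42, arXiv:1710.05205
[crux, rank 2; TAG WEAKER (R1 = SpinUpRougheningTG ⟹ this PROVED: OnsagerWindow.lean
sobolevRoughening_of_spinUpRoughening, kernel, via the real→ℝ≥0∞ bridge ofReal_le_eMean_grad and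
|k|^{2s} ≥ |k|²; this ⇏ R1: shape class B = Ḣ¹-bounded/Ḣ^{3/2+}-unbounded statistics (internal
layers u_ℓ = ℓ^{1/2}Φ(x₂/ℓ)e₀: ‖∇u_ℓ‖₂ ≍ 1, |u_ℓ|_{Ḣ^s} ≍ ℓ^{1−s}), emptiness of B at the pin = the
sibling OnsagerWindowTG; probe vs parent CLEAN); LEAF ATTACKABLE NOW, THEOREM-GRADE (line S1
symmetric Leray–Hopf existence from rest via tree IsHopfGalerkinScheme.exists_isGlobalLerayHopf +
equivariance, S2 mollified loop current w_δ = G_δ∗j_C of C = ∂([0,½]²×{x₂=0}) with ∫⟪f_TG,w_δ⟫ →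
4/π, S3 pinned-loop commutator estimate |∫(v⊗v):∇w_δ| ≤ C δ^{2s'−3}|v|²_{Ḣ^s} (3/2 < s' < s ≤ 2) for
K-symmetric div-free v — resolved loop flux vanishes EXACTLY on the skeleton, CET remainder via
shift gain + L²-trace of H^{1+η}(T³) on axis-parallel edges, S4 tested balance + energy growth
‖u(T)‖₂² ≤ 2‖f‖₂T^{1/2}(∫₀ᵀ‖u‖₂²)^{1/2}, S5 contradiction as T→∞, δ→0, ν→0; hardest S3, size L) +
INSTRUMENTABLE (census TKR-v1 T-KR2: N_{3/2} ∝ r^{−(1.6…1.9)}, N_2 ∝ r^{−(2.3…2.7)} over r = ν/ν_ref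
= 1/32…1/512); BC5 plan-only static rung Sob -/
@[route_item "route-AnomalousDissipation-StrainDichotomy", crux]
def SobolevRougheningTG : Prop :=
  ∀ f : UnitAddTorus (Fin 3) → EuclideanSpace ℝ (Fin 3), f = (fun x => !₂[(fourier 1 (x 0) : ℂ).im * (fourier 1 (x 1) : ℂ).re * (fourier 1 (x 2) : ℂ).re, -((fourier 1 (x 0) : ℂ).re * (fourier 1 (x 1) : ℂ).im * (fourier 1 (x 2) : ℂ).re), (0 : ℝ)]) → ∀ s : ℝ, 3 / 2 < s → ∀ M : ℝ, ∃ ν₁ : ℝ, 0 < ν₁ ∧ ∀ ν : ℝ, 0 < ν → ν < ν₁ → ∃ u : ℝ → UnitAddTorus (Fin 3) → EuclideanSpace ℝ (Fin 3), Literature.Analysis.FluidPDE.Torus.IsGlobalLerayHopf ν (fun _ => f) 0 u ∧ ENNReal.ofReal M ≤ Filter.limsup (fun T : ℝ => (ENNReal.ofReal T)⁻¹ * ∫⁻ t in Set.Ioc (0 : ℝ) T, Literature.Analysis.FunctionSpaces.Torus.eHomSobolevSeminorm s (Literature.Analysis.FunctionSpaces.EuclideanSpace.complexify ∘ u t) ^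 2) Filter.atTop

/-- item stmt-AnomalousDissipation-24256 · crux · rank 5 · open · by planner
why it might fail: hard-core energy axis: the from-rest TG energy may grow like ν^(-a) as ν → 0 (condensate-type pile-up at the forcing scale); no ν-uniform ceiling mechanism at a pumped 3-D force is known.
sources: DoeringFoias2002, doi:10.1017/s0022112083001159, ConstantinTarfuleaVicol2013
[crux] [crux; TAG WEAKER-operative (critic CLEARED 2026-08-30T01:32:34Z: «∀-LH-from-rest limsup-mean
ceiling at the pin; not ⟹ S; separating model class II typed» = hard_core ENERGY AXIS, critic G5);
LEAF: BARRIER/IDEA-NEEDED (no mechanism for a ν-uniform ceiling at a pumped force is known; energy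
methods stop at ⟨‖u‖²⟩ ≲ ‖f‖²/ν²) + INSTRUMENTABLE (sup-energy from rest 0.67–0.71 flat over r =
1/16…1/512, ROUND-9 ADDENDA C–F; census rows WK4/IN1); immune to the all-data ceiling refutations
negatives 2979/2984 (constant data of large mean) because the datum is pinned to 0 and momentum is
conserved; BC5 rung BY NAME: Theorems.CorrelationEnergyUnboundedNeg_refuted (class II swept shear: a
ν-uniformly bounded, quiet explicit LH family — the ceiling shape decided TRUE where the floor
fails), positive packaging SweptShearBoundedQuiet plan-only] SPIN-UP CEILING AT f_TG: there are E
and ν₀ > 0 such that for every ν ∈ (0, ν₀) EVERY global Leray–Hopf solution from rest driven by f_TG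
has limsup-mean energy meanEnergy u ≤ E. KILL: resolved DNS or CAP showing the from-rest energy
growing like ν^{-a} (a > 0) over a further decade. [difficulty: open-problem] -/
@[route_item "route-AnomalousDissipation-StrainDichotomy", crux]
def RestMeanCeilingTG : Prop :=
  ∀ f : UnitAddTorus (Fin 3) → EuclideanSpace ℝ (Fin 3), f = (fun x => !₂[(fourier 1 (x 0) : ℂ).im * (fourier 1 (x 1) : ℂ).re * (fourier 1 (x 2) : ℂ).re, -((fourier 1 (x 0) : ℂ).re * (fourier 1 (x 1) : ℂ).im * (fourier 1 (x 2) : ℂ).re), (0 : ℝ)]) → ∃ E ν₀ : ℝ, 0 < ν₀ ∧ ∀ ν : ℝ, 0 < ν → ν < ν₀ → ∀ u : ℝ → UnitAddTorus (Fin 3) → EuclideanSpace ℝ (Fin 3), Literature.Analysis.FluidPDE.Torus.IsGlobalLerayHopf ν (fun _ => f) 0 u → Literature.Analysis.FluidPDE.meanEnergy u ≤ E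

/-- item stmt-AnomalousDissipation-29900 · support · rank 6 · open · by planner
why it might fail: rate selection: intermediate roughening ⟨‖∇u‖²⟩ ≍ ν^(-a), a < 1 may be what the TG spin-up does; nothing known pins a = 1 at f_TG (2A:25780's risk verbatim).
sources: Frisch1995, DoeringFoias2002, doi:10.1017/s0022112083001159
[crux] SHARED BY SIGNATURE with RootDecompCycle2A item 25780 (crux 3, 2A's other DECLARED RESIDUAL;
filed FULLY INLINED: 25779-text → 24255-text; by-name form SpinUpRougheningTG → RestMeanFloorTG;
untouched by this node): ROUGHENING FORCES THE KOLMOGOROV RATE AT f_TG — unbounded mean enstrophy of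
the spin-up ⇒ a uniform dissipation floor ε > 0. [difficulty: open-problem] -/
@[route_item "route-AnomalousDissipation-StrainDichotomy", crux]
def RougheningRateUpgradeTG : Prop :=
  (∀ f : UnitAddTorus (Fin 3) → EuclideanSpace ℝ (Fin 3), f = (fun x => !₂[(fourier 1 (x 0) : ℂ).im * (fourier 1 (x 1) : ℂ).re * (fourier 1 (x 2) : ℂ).re, -((fourier 1 (x 0) : ℂ).re * (fourier 1 (x 1) : ℂ).im * (fourier 1 (x 2) : ℂ).re), (0 : ℝ)]) → ∀ M : ℝ, ∃ ν₁ : ℝ, 0 < ν₁ ∧ ∀ ν : ℝ, 0 < ν → ν < ν₁ → ∃ u : ℝ → UnitAddTorus (Fin 3) → EuclideanSpace ℝ (Fin 3), Literature.Analysis.FluidPDE.Torus.IsGlobalLerayHopf ν (fun _ => f) 0 u ∧ M * ν ≤ Literature.Analysis.FluidPDE.meanDissipation ν u) → (∀ f : UnitAddTorus (Fin 3) → EuclideanSpace ℝ (Fin 3), f = (fun x => !₂[(fourier 1 (x 0) : ℂ).im * (fourier 1 (x 1) : ℂ).re * (fourier 1 (x 2) : ℂ).re, -((fourier 1 (x 0)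 : ℂ).re * (fourier 1 (x 1) : ℂ).im * (fourier 1 (x 2) : ℂ).re), (0 : ℝ)]) → ∃ ε ν₁ : ℝ, 0 < ε ∧ 0 < ν₁ ∧ ∀ ν : ℝ, 0 < ν → ν < ν₁ → ∃ u : ℝ → UnitAddTorus (Fin 3) → EuclideanSpace ℝ (Fin 3), Literature.Analysis.FluidPDE.Torus.IsGlobalLerayHopf ν (fun _ => f) 0 u ∧ ε ≤ Literature.Analysis.FluidPDE.meanDissipation ν u)

/-- item stmt-AnomalousDissipation-29985 · support · rank 9 · open · by planner
why it might fail: Not in substance (Galerkin in the K-symmetric class; f_TG is K-symmetric); size: joint measurability of a representative of ∇u ∈ L²(0,T;L²).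
sources: Hopf1951, Galdi2000, Temam1977
[support · P₀ · THEOREM-GRADE M · ATTACKABLE NOW · piece of the binder StrainDichotomyWindowTG
(writer sketch window_of_pieces) and hypothesis of RoughStrainRougheningTG (inlined there);
decomp-ad lens-2 g5 NODE StrainDichotomy v3 (HOME/decomp-ad-lens-2/StrainDichotomy.lean sha256
3c716ef34762ee1d; critic CLEARED 2026-08-30T06:51:26Z; writer paste check g4/SD/SketchSD.lean rc0,
chk_* := Iff.rfl)]  [support, rank 9; THEOREM-GRADE M; = stub_symmLH of the g3/g4/g5 skeleton lines]
support P₀ (rank 9) — THEOREM-GRADE (M), tag WEAKER · SYMMETRIC LERAY–HOPF EXISTENCE WITH WITNESSES: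
for every ν > 0 there is a global Leray–Hopf solution u from rest at f_TG which is K-symmetric for
all t (`u t (update x i (−x i)) j = if j = i then −u t x j else u t x j`) and a jointly measurable
family g : ℝ → Fin 3 → (𝕋³ → E³) with g t j ∈ L² and `HasWeakPartialDeriv j (u t) (g t j)` for a.e.
t > 0. Proof plan: Galerkin in the K-symmetric class (tree
`IsHopfGalerkinScheme.exists_isGlobalLerayHopf` + equivariance of the projected equation; f_TG is
K-symmetric), witnesses = a strongly measurable representative of ∇u ∈ L²(0,T;L²) from the field
`memL2Sobolev`. Why it might fail: not in substance; size/typing -/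
@[route_item "route-AnomalousDissipation-StrainDichotomy"]
def SymmetricLerayHopfTG : Prop :=
  ∀ f : UnitAddTorus (Fin 3) → EuclideanSpace ℝ (Fin 3), f = (fun x => !₂[(fourier 1 (x 0) : ℂ).im * (fourier 1 (x 1) : ℂ).re * (fourier 1 (x 2) : ℂ).re, -((fourier 1 (x 0) : ℂ).re * (fourier 1 (x 1) : ℂ).im * (fourier 1 (x 2) : ℂ).re), (0 : ℝ)]) → ∀ ν : ℝ, 0 < ν → ∃ u : ℝ → UnitAddTorus (Fin 3) → EuclideanSpace ℝ (Fin 3), Literature.Analysis.FluidPDE.Torus.IsGlobalLerayHopf ν (fun _ => f) 0 u ∧ (∀ (t : ℝ) (i j : Fin 3) (x : UnitAddTorus (Fin 3)), u t (Function.update x i (-x i)) j = if j = i then -(u t x j) else u t x j) ∧ ∃ g : ℝ → Fin 3 → UnitAddTorus (Fin 3) → EuclideanSpace ℝ (Fin 3), (∀ j : Fin 3, Measurable (Function.uncurry fun t x => g t j x)) ∧ (∀ᵐ t : ℝ, 0 < t → ∀ j : Fin 3, MemLp (g t j) 2 volume ∧ Literature.Analysis.FunctionSpaces.Torus.HasWeakPartialDeriv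 j (u t) (g t j))

/-- item stmt-AnomalousDissipation-29986 · support · rank 9 · open · by planner
why it might fail: Not in substance: nested-cube telescoping + adjacent-cube Poincaré (scale-free) + 1-D Wirtinger; risk = UnitAddTorus box bookkeeping (δ₀ ≤ 1/4) and Bochner averages of L² fields.
sources: Stein1970, FeffermanStein1972, doi:10.1007/BF00252910
[support · P₁ · TEXTBOOK M on paper / L in Lean · ATTACKABLE NOW · fieldwise real analysis, no
Navier–Stokes · piece of StrainDichotomyWindowTG; critic 06:51:26Z checked the dyadic variance
Carleson sum against three stress cases (finest-tube concentration, log profile, scale-δ_j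
oscillation) — holds with room; decomp-ad lens-2 g5 NODE StrainDichotomy v3
(HOME/decomp-ad-lens-2/StrainDichotomy.lean sha256 3c716ef34762ee1d; critic CLEARED
2026-08-30T06:51:26Z; writer paste check g4/SD/SketchSD.lean rc0, chk_* := Iff.rfl)]  [support, rank
9; TEXTBOOK M, fieldwise real analysis, no Navier–Stokes] support P₁ (rank 9) — TEXTBOOK (M), tag
WEAKER · DYADIC BOX-VARIANCE CARLESON SUM (fieldwise, no Navier–Stokes): ∃ C > 0, for all 0 < δ₀ ≤
1/4, K ∈ ℕ, v ∈ L²(𝕋³;E³) with L²-witnesses G j of ∂_j v:  Σ_{k<K} Ξ_{δ₀/2^k}(v) ≤ C·(Z_{δ₀}(G) +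
Σ_{k<K} S_{δ₀/2^k}(G)) — the box variances of the axial component over K nested dyadic scales are
paid ONCE by the tube enstrophy plus once per scale by the diagonal (axial) strain. Proof: per box,
variance about the box mean ≤ ∫_{s'}∫_{Q}|v − a(s')|² + |Q|∫|a − ā|² (a = cross-section mean; exact
orthogonal split); the second term ≤ (2δ/π)²∫_{B}|∂_t v_t|² (1-D -/
@[route_item "route-AnomalousDissipation-StrainDichotomy"]
def SkeletonCarlesonTG : Prop :=
  ∃ C : ℝ, 0 < C ∧ ∀ δ₀ : ℝ, 0 < δ₀ → δ₀ ≤ 1 / 4 → ∀ K : ℕ, ∀ v : UnitAddTorus (Fin 3) → EuclideanSpace ℝ (Fin 3), MemLp v 2 volume → ∀ G : Fin 3 → UnitAddTorus (Fin 3) → EuclideanSpace ℝ (Fin 3), (∀ j : Fin 3, MemLp (G j) 2 volume ∧ Literature.Analysis.FunctionSpaces.Torus.HasWeakPartialDeriv j v (G j)) → ∑ k ∈ Finset.range K, (ENNReal.ofReal (1 / (δ₀ / 2 ^ k) ^ 3) * ∫⁻ s in Set.Ioc (0 : ℝ) 1, ((∫⁻ x in {x : UnitAddTorus (Fin 3)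 | ‖x 0 - ((s : ℝ) : UnitAddCircle)‖ < (δ₀ / 2 ^ k) ∧ ‖x 1‖ < (δ₀ / 2 ^ k) ∧ ‖x 2‖ < (δ₀ / 2 ^ k)}, ‖v x 0 - (8 * (δ₀ / 2 ^ k) ^ 3)⁻¹ * ∫ y in {x : UnitAddTorus (Fin 3) | ‖x 0 - ((s : ℝ) : UnitAddCircle)‖ < (δ₀ / 2 ^ k) ∧ ‖x 1‖ < (δ₀ / 2 ^ k) ∧ ‖x 2‖ < (δ₀ / 2 ^ k)}, v y 0‖ₑ ^ 2) + (∫⁻ x in {x : UnitAddTorus (Fin 3) | ‖x 0 - ((s : ℝ) : UnitAddCircle)‖ < (δ₀ / 2 ^ k) ∧ ‖x 1 - ((1 / 2 : ℝ) : UnitAddCircle)‖ < (δ₀ / 2 ^ k) ∧ ‖x 2‖ < (δ₀ / 2 ^ k)}, ‖v x 0 - (8 * (δ₀ / 2 ^ k) ^ 3)⁻¹ * ∫ y in {x : UnitAddTorus (Fin 3) | ‖x 0 - ((s : ℝ) : UnitAddCircle)‖ < (δ₀ / 2 ^ k) ∧ ‖x 1 - ((1 / 2 : ℝ) : UnitAddCircle)‖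 < (δ₀ / 2 ^ k) ∧ ‖x 2‖ < (δ₀ / 2 ^ k)}, v y 0‖ₑ ^ 2) + (∫⁻ x in {x : UnitAddTorus (Fin 3) | ‖x 0‖ < (δ₀ / 2 ^ k) ∧ ‖x 1 - ((s : ℝ) : UnitAddCircle)‖ < (δ₀ / 2 ^ k) ∧ ‖x 2‖ < (δ₀ / 2 ^ k)}, ‖v x 1 - (8 * (δ₀ / 2 ^ k) ^ 3)⁻¹ * ∫ y in {x : UnitAddTorus (Fin 3) | ‖x 0‖ < (δ₀ / 2 ^ k) ∧ ‖x 1 - ((s : ℝ) : UnitAddCircle)‖ < (δ₀ / 2 ^ k) ∧ ‖x 2‖ < (δ₀ / 2 ^ k)}, v y 1‖ₑ ^ 2) + (∫⁻ x in {x : UnitAddTorus (Fin 3) | ‖x 0 - ((1 / 2 : ℝ) : UnitAddCircle)‖ < (δ₀ / 2 ^ k) ∧ ‖x 1 - ((s : ℝ) : UnitAddCircle)‖ < (δ₀ / 2 ^ k) ∧ ‖x 2‖ < (δ₀ / 2 ^ k)}, ‖v x 1 - (8 * (δ₀ / 2 ^ k) ^ 3)⁻¹ * ∫ y in {x : UnitAddTorus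 (Fin 3) | ‖x 0 - ((1 / 2 : ℝ) : UnitAddCircle)‖ < (δ₀ / 2 ^ k) ∧ ‖x 1 - ((s : ℝ) : UnitAddCircle)‖ < (δ₀ / 2 ^ k) ∧ ‖x 2‖ < (δ₀ / 2 ^ k)}, v y 1‖ₑ ^ 2))) ≤ ENNReal.ofReal C * ((∫⁻ x in {x : UnitAddTorus (Fin 3) | (‖x 1‖ < δ₀ ∨ ‖x 1 - ((1 / 2 : ℝ) : UnitAddCircle)‖ < δ₀ ∨ ‖x 0‖ < δ₀ ∨ ‖x 0 - ((1 / 2 : ℝ) : UnitAddCircle)‖ < δ₀) ∧ ‖x 2‖ < δ₀}, ∑ j : Fin 3, ‖G j x‖ₑ ^ 2) + ∑ k ∈ Finset.range K, (∫⁻ x in {x : UnitAddTorus (Fin 3) | (‖x 1‖ < (δ₀ / 2 ^ k) ∨ ‖x 1 - ((1 / 2 : ℝ) : UnitAddCircle)‖ < (δ₀ / 2 ^ k) ∨ ‖x 0‖ < (δ₀ / 2 ^ k) ∨ ‖x 0 - ((1 / 2 : ℝ) : UnitAddCircle)‖ < (δ₀ / 2 ^ k)) ∧ ‖x 2‖ <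 (δ₀ / 2 ^ k)}, ∑ i : Fin 3, ‖G i x i‖ₑ ^ 2))

/-- item stmt-AnomalousDissipation-29987 · support · rank 9 · open · by planner
why it might fail: Only through the junk value of the real limsup `longTimeAvgSup` if Cesàro means of eGradNormSq were unbounded — excluded by the strong energy inequality (field energy_ineq_ae) + zero mean/Poincaré.
sources: Galdi2000, DoeringFoias2002, Temam1977
[support · P₂ · TEXTBOOK S–M · ATTACKABLE NOW · δ-free bridge witness enstrophy → meanDissipation ·
piece of StrainDichotomyWindowTG; decomp-ad lens-2 g5 NODE StrainDichotomy v3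
(HOME/decomp-ad-lens-2/StrainDichotomy.lean sha256 3c716ef34762ee1d; critic CLEARED
2026-08-30T06:51:26Z; writer paste check g4/SD/SketchSD.lean rc0, chk_* := Iff.rfl)]  [support, rank
9; TEXTBOOK S–M] support P₂ (rank 9) — TEXTBOOK (S–M), tag WEAKER · WITNESS-ENSTROPHY-TO-DISSIPATION
BRIDGE (δ-free): for every ν > 0, every global Leray–Hopf solution u from rest at f_TG, all
L²-witnesses g of ∇u (a.e. t > 0) and every M : ℝ — if ofReal M ≤ limsup_T of the Cesàro mean of the
TOTAL witness enstrophy ∫_{𝕋³} Σ_j |g t j x|², then M·ν ≤ meanDissipation ν u (the route's real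
`longTimeAvgSup` of ν·eGradNormSq). Proof: Σ_j ‖g t j‖²_{L²} = eGradNormSq (u t) for a.e. t (weak
derivative = spectral gradient, Plancherel); the Cesàro means of eGradNormSq are BOUNDED (strong
energy inequality `energy_ineq_ae` from a.e. s + zero mean/Poincaré ⇒ sup_t ‖u(t)‖₂ < ∞ ⇒
T⁻¹ν∫₀ᵀ‖∇u‖² ≤ ‖f‖·sup‖u‖ + O(1/T)), so the real limsup is a genuine limsup and equals ν·(ENNReal
limsup).toReal. Why it might fail: only via the junk value of th -/
@[route_item "route-AnomalousDissipation-StrainDichotomy"]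
def WitnessDissipationBridgeTG : Prop :=
  ∀ ν : ℝ, 0 < ν → ∀ f : UnitAddTorus (Fin 3) → EuclideanSpace ℝ (Fin 3), f = (fun x => !₂[(fourier 1 (x 0) : ℂ).im * (fourier 1 (x 1) : ℂ).re * (fourier 1 (x 2) : ℂ).re, -((fourier 1 (x 0) : ℂ).re * (fourier 1 (x 1) : ℂ).im * (fourier 1 (x 2) : ℂ).re), (0 : ℝ)]) → ∀ u : ℝ → UnitAddTorus (Fin 3) → EuclideanSpace ℝ (Fin 3), Literature.Analysis.FluidPDE.Torus.IsGlobalLerayHopf ν (fun _ => f) 0 u → ∀ g : ℝ → Fin 3 → UnitAddTorus (Fin 3) → EuclideanSpace ℝ (Fin 3), (∀ᵐ t : ℝ, 0 < t → ∀ j : Fin 3, MemLp (g t j) 2 volume ∧ Literature.Analysis.FunctionSpaces.Torus.HasWeakPartialDeriv j (u t) (g t j)) → ∀ M : ℝ, ENNReal.ofReal M ≤ Filter.limsup (fun T : ℝ => ((ENNReal.ofReal T)⁻¹ * ∫⁻ t in Set.Ioc (0 : ℝ) T, (∫⁻ x, ∑ j : Fin 3, ‖g t j x‖ₑ ^ 2)))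 Filter.atTop → M * ν ≤ Literature.Analysis.FluidPDE.meanDissipation ν u

/-- item stmt-AnomalousDissipation-29988 · aside · rank 9 · open · by planner
sources: ChildressKerswellGilbert2001, Frisch1995
[aside · WORLD PROPOSITION W «quiet ⇒ tame», never staffed as such (its text is inlined as ¬W inside
RoughStrainRougheningTG and by name in TameStrainRougheningTG); proving W outright is the natural
proof of the residual RoughStrainRougheningTG; decomp-ad lens-2 g5 NODE StrainDichotomy v3
(HOME/decomp-ad-lens-2/StrainDichotomy.lean sha256 3c716ef34762ee1d; critic CLEARED
2026-08-30T06:51:26Z; writer paste check g4/SD/SketchSD.lean rc0, chk_* := Iff.rfl)]  [aside / WORLD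
PROPOSITION W of the g5 dichotomy, never staffed; needed as a decl because RoughStrainRougheningTG
(and TameStrainRougheningTG) mention it] WORLD PROPOSITION W (definition-like aside, never staffed;
the branch condition; v3 = CONDITIONED ON QUIETNESS): «QUIET ⇒ TAME diagonal strain at the skeleton»
— for every level L : ℝ there are K δ₀ ν₀ (0 < δ₀, 0 < ν₀) such that for all 0 < ν < ν₀, EVERY
K-symmetric Leray–Hopf solution u from rest at f_TG with L²-witnesses g whose TOTAL witness
enstrophy is quiet at level L (limsup_T of the Cesàro mean of ∫_{𝕋³} Σ_j |g t j x|² ≤ ofReal L) has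
Ŝ_δ ≤ K·δ² for all 0 < δ ≤ δ₀ (bounded mean-square DENSITY of the diagonal strain on the skeleton
tube: true if quiet symmetric flows are -/
@[route_item "route-AnomalousDissipation-StrainDichotomy"]
def SkeletonStrainTameTG : Prop :=
  ∀ f : UnitAddTorus (Fin 3) → EuclideanSpace ℝ (Fin 3), f = (fun x => !₂[(fourier 1 (x 0) : ℂ).im * (fourier 1 (x 1) : ℂ).re * (fourier 1 (x 2) : ℂ).re, -((fourier 1 (x 0) : ℂ).re * (fourier 1 (x 1) : ℂ).im * (fourier 1 (x 2) : ℂ).re), (0 : ℝ)]) → ∀ L : ℝ, ∃ K δ₀ ν₀ : ℝ, 0 < δ₀ ∧ 0 < ν₀ ∧ ∀ ν : ℝ, 0 < ν → ν < ν₀ → ∀ u : ℝ → UnitAddTorus (Fin 3) → EuclideanSpace ℝ (Fin 3), Literature.Analysis.FluidPDE.Torus.IsGlobalLerayHopf ν (fun _ => f) 0 u → (∀ (t : ℝ) (i j : Fin 3) (x : UnitAddTorus (Fin 3)), u t (Function.update x i (-x i)) j = if j = i then -(u t x j) else u t x j) → ∀ g : ℝ → Fin 3 → UnitAddTorus (Fin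 3) → EuclideanSpace ℝ (Fin 3), (∀ᵐ t : ℝ, 0 < t → ∀ j : Fin 3, MemLp (g t j) 2 volume ∧ Literature.Analysis.FunctionSpaces.Torus.HasWeakPartialDeriv j (u t) (g t j)) → Filter.limsup (fun T : ℝ => ((ENNReal.ofReal T)⁻¹ * ∫⁻ t in Set.Ioc (0 : ℝ) T, (∫⁻ x, ∑ j : Fin 3, ‖g t j x‖ₑ ^ 2))) Filter.atTop ≤ ENNReal.ofReal L → ∀ δ : ℝ, 0 < δ → δ ≤ δ₀ → Filter.limsup (fun T : ℝ => ((ENNReal.ofReal T)⁻¹ * ∫⁻ t in Set.Ioc (0 : ℝ) T, (∫⁻ x in {x : UnitAddTorus (Fin 3) | (‖x 1‖ < δ ∨ ‖x 1 - ((1 / 2 : ℝ) : UnitAddCircle)‖ < δ ∨ ‖x 0‖ < δ ∨ ‖x 0 - ((1 / 2 : ℝ) : UnitAddCircle)‖ < δ) ∧ ‖x 2‖ < δ}, ∑ i : Fin 3, ‖g t i x i‖ₑ ^ 2))) Filter.atTop ≤ ENNReal.ofReal (K * δ ^ 2)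

/-- item stmt-AnomalousDissipation-29989 · support · rank 9 · open · by planner
why it might fail: It cannot: kernel-checked in the node file (0 sorry, Mathlib axioms only); only a port-size risk (ENNReal liminf/limsup bookkeeping, Tonelli).
sources: run/shared/lean/pub/decomp-ad/decomp-ad-lens-2/StrainDichotomy.lean, Stein1970
[support · SPECIAL BRANCH · PROVED in the node file (theorem tameStrainRoughening_holds /
tameBranch_of_varianceLaw, ≈175 lines, 0 sorry; port verbatim to Theorems/) · provable-now · the
fourth piece of StrainDichotomyWindowTG (window_of_pieces: excluded middle on W); statement by name
over this route's decls, conclusion RootDecompCycle2A.SpinUpRougheningTG; decomp-ad lens-2 g5 NODE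
StrainDichotomy v3 (HOME/decomp-ad-lens-2/StrainDichotomy.lean sha256 3c716ef34762ee1d; critic
CLEARED 2026-08-30T06:51:26Z; writer paste check g4/SD/SketchSD.lean rc0, chk_* := Iff.rfl)]
[support; SPECIAL BRANCH — PROVED (0 sorry) in the node file
run/shared/lean/pub/decomp-ad/decomp-ad-lens-2/StrainDichotomy.lean (theorem
tameStrainRoughening_holds / tameBranch_of_varianceLaw, ~170 lines: multi-scale variance core +
dyadic Carleson count); file it only if the ledger wants the closed edge on record — a prover
re-lands the node proof under Theorems/] support C₂♯ — the SPECIAL BRANCH, PROVED IN THIS FILE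
(theorem `tameStrainRoughening_holds`, 0 sorry; nothing to staff): `SkeletonVarianceLawTG →
SymmetricLerayHopfTG → SkeletonCarlesonTG → WitnessDissipationBridgeTG → W → R1` — if quiet
symmetric spin-ups -/
@[route_item "route-AnomalousDissipation-StrainDichotomy"]
def TameStrainRougheningTG : Prop :=
  SkeletonVarianceLawTG → SymmetricLerayHopfTG → SkeletonCarlesonTG → WitnessDissipationBridgeTG → SkeletonStrainTameTG → Summit.AnomalousDissipation.AnomalousDissipation.Theses.RootDecompCycle2A.SpinUpRougheningTG

/-- item stmt-AnomalousDissipation-29990 · aside · rank 9 · open · by planner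
sources: Frisch1995, doi:10.1007/BF02099744
[aside · BC5 PLAN-ONLY RUNG of SkeletonVarianceLawTG (T3-plan-only): classical K-symmetric STEADY
Navier–Stokes states at f_TG, provable now (M) by (★) + the steady tested balance; outside S's known
regime (constrains every steady symmetric state at every ν, where neither S nor R1 is known);
decomp-ad lens-2 g5 NODE StrainDichotomy v3 (HOME/decomp-ad-lens-2/StrainDichotomy.lean sha256
3c716ef34762ee1d; critic CLEARED 2026-08-30T06:51:26Z; writer paste check g4/SD/SketchSD.lean rc0,
chk_* := Iff.rfl)]  [aside; BC5 PLAN-ONLY static rung of SkeletonVarianceLawTG, PROVABLE NOW (M);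
needs `Literature.Analysis.FunctionSpaces.Torus.IsClassicalNSSolutionOn` (import as in
Theses.PumpedMirror)] aside, BC5 PLAN-ONLY steady classical shadow of C₁♯ (the first rung a prover
can land with classical calculus, no Leray–Hopf measure theory): for every ν > 0, every CLASSICAL
K-symmetric steady solution (u, p) of Navier–Stokes on 𝕋³ forced by f_TG satisfies, for all small δ,
c·δ ≤ (Ξ_δ·S_δ)^{1/2} + S_δ + (Bν/δ)·Z_δ^{1/2} with real integrals of the classical partial
derivatives (Ξ = box variance of the axial velocity along the skeleton lines, S = diagonal strain, Z
= enstrophy on TT_δ). Named technique -/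
@[route_item "route-AnomalousDissipation-StrainDichotomy"]
def SteadyVarianceLawTG : Prop :=
  ∀ f : UnitAddTorus (Fin 3) → EuclideanSpace ℝ (Fin 3), f = (fun x => !₂[(fourier 1 (x 0) : ℂ).im * (fourier 1 (x 1) : ℂ).re * (fourier 1 (x 2) : ℂ).re, -((fourier 1 (x 0) : ℂ).re * (fourier 1 (x 1) : ℂ).im * (fourier 1 (x 2) : ℂ).re), (0 : ℝ)]) → ∃ c B δ₁ : ℝ, 0 < c ∧ 0 < B ∧ 0 < δ₁ ∧ ∀ (ν : ℝ) (u : UnitAddTorus (Fin 3) → EuclideanSpace ℝ (Fin 3)) (p : UnitAddTorus (Fin 3) → ℝ), 0 < ν → Literature.Analysis.FunctionSpaces.Torus.IsClassicalNSSolutionOn Set.univ ν (fun _ => f) (fun _ => u) (fun _ => p) → (∀ (i j : Fin 3) (x : UnitAddTorus (Fin 3)), u (Function.update x i (-x i)) j = if j = i then -(u x j) else u x j) → ∀ δ : ℝ, 0 < δ → δ ≤ δ₁ → c * δ ≤ Real.sqrt (((1 / δ ^ 3) * ∫ s in Set.Ioc (0 : ℝ) 1, ((∫ x in {x : UnitAddTorus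 (Fin 3) | ‖x 0 - ((s : ℝ) : UnitAddCircle)‖ < δ ∧ ‖x 1‖ < δ ∧ ‖x 2‖ < δ}, (u x 0 - (8 * δ ^ 3)⁻¹ * ∫ y in {x : UnitAddTorus (Fin 3) | ‖x 0 - ((s : ℝ) : UnitAddCircle)‖ < δ ∧ ‖x 1‖ < δ ∧ ‖x 2‖ < δ}, u y 0) ^ 2) + (∫ x in {x : UnitAddTorus (Fin 3) | ‖x 0 - ((s : ℝ) : UnitAddCircle)‖ < δ ∧ ‖x 1 - ((1 / 2 : ℝ) : UnitAddCircle)‖ < δ ∧ ‖x 2‖ < δ}, (u x 0 - (8 * δ ^ 3)⁻¹ * ∫ y in {x : UnitAddTorus (Fin 3) | ‖x 0 - ((s : ℝ) : UnitAddCircle)‖ < δ ∧ ‖x 1 - ((1 / 2 : ℝ) : UnitAddCircle)‖ < δ ∧ ‖x 2‖ < δ}, u y 0) ^ 2) + (∫ x in {x : UnitAddTorus (Fin 3) | ‖x 0‖ < δ ∧ ‖x 1 - ((s : ℝ) : UnitAddCircle)‖ < δ ∧ ‖x 2‖ < δ}, (u x 1 - (8 * δ ^ 3)⁻¹ * ∫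 y in {x : UnitAddTorus (Fin 3) | ‖x 0‖ < δ ∧ ‖x 1 - ((s : ℝ) : UnitAddCircle)‖ < δ ∧ ‖x 2‖ < δ}, u y 1) ^ 2) + (∫ x in {x : UnitAddTorus (Fin 3) | ‖x 0 - ((1 / 2 : ℝ) : UnitAddCircle)‖ < δ ∧ ‖x 1 - ((s : ℝ) : UnitAddCircle)‖ < δ ∧ ‖x 2‖ < δ}, (u x 1 - (8 * δ ^ 3)⁻¹ * ∫ y in {x : UnitAddTorus (Fin 3) | ‖x 0 - ((1 / 2 : ℝ) : UnitAddCircle)‖ < δ ∧ ‖x 1 - ((s : ℝ) : UnitAddCircle)‖ < δ ∧ ‖x 2‖ < δ}, u y 1) ^ 2))) * (∫ x in {x : UnitAddTorus (Fin 3) | (‖x 1‖ < δ ∨ ‖x 1 - ((1 / 2 : ℝ) : UnitAddCircle)‖ < δ ∨ ‖x 0‖ < δ ∨ ‖x 0 - ((1 / 2 : ℝ) : UnitAddCircle)‖ < δ) ∧ ‖x 2‖ < δ}, ∑ i : Fin 3, (Literature.Analysis.FunctionSpaces.Torus.partialDeriv i u x i) ^ 2)) + (∫ x in {x : UnitAddTorus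 (Fin 3) | (‖x 1‖ < δ ∨ ‖x 1 - ((1 / 2 : ℝ) : UnitAddCircle)‖ < δ ∨ ‖x 0‖ < δ ∨ ‖x 0 - ((1 / 2 : ℝ) : UnitAddCircle)‖ < δ) ∧ ‖x 2‖ < δ}, ∑ i : Fin 3, (Literature.Analysis.FunctionSpaces.Torus.partialDeriv i u x i) ^ 2) + B * ν / δ * Real.sqrt (∫ x in {x : UnitAddTorus (Fin 3) | (‖x 1‖ < δ ∨ ‖x 1 - ((1 / 2 : ℝ) : UnitAddCircle)‖ < δ ∨ ‖x 0‖ < δ ∨ ‖x 0 - ((1 / 2 : ℝ) : UnitAddCircle)‖ < δ) ∧ ‖x 2‖ < δ}, ∑ j : Fin 3, ‖Literature.Analysis.FunctionSpaces.Torus.partialDeriv j u x‖ ^ 2)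

/-- item stmt-AnomalousDissipation-30698 · aside · rank 9 · open · by planner
sources: run/shared/lean/pub/decomp-ad/decomp-ad-lens-2/HarmonicStrain.lean, DoeringFoias2002
[aside · W_log · WORLD PROPOSITION, never staffed] world proposition W_log «quiet ⇒ log-tame
skeleton strain» at f_TG: text of SkeletonStrainTameTG (29988) with K*δ^2 replaced by
K*(1+Real.log(δ₀/δ))*δ^2; logTame_of_tame : W → W_log (node file l.432). Must be added BEFORE the
split children (they mention it by name). -/
@[route_item "route-AnomalousDissipation-StrainDichotomy"]
def SkeletonStrainLogTameTG : Prop :=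
  ∀ f : UnitAddTorus (Fin 3) → EuclideanSpace ℝ (Fin 3), f = (fun x => !₂[(fourier 1 (x 0) : ℂ).im * (fourier 1 (x 1) : ℂ).re * (fourier 1 (x 2) : ℂ).re, -((fourier 1 (x 0) : ℂ).re * (fourier 1 (x 1) : ℂ).im * (fourier 1 (x 2) : ℂ).re), (0 : ℝ)]) → ∀ L : ℝ, ∃ K δ₀ ν₀ : ℝ, 0 < δ₀ ∧ 0 < ν₀ ∧ ∀ ν : ℝ, 0 < ν → ν < ν₀ → ∀ u : ℝ → UnitAddTorus (Fin 3) → EuclideanSpace ℝ (Fin 3), Literature.Analysis.FluidPDE.Torus.IsGlobalLerayHopf ν (fun _ => f) 0 u → (∀ (t : ℝ) (i j : Fin 3) (x : UnitAddTorus (Fin 3)), u t (Function.update x i (-x i)) j = if j = i then -(u t x j) else u t x j) → ∀ g : ℝ → Fin 3 → UnitAddTorus (Fin 3) → EuclideanSpace ℝ (Fin 3), (∀ᵐ t : ℝ, 0 < t → ∀ j : Fin 3, MemLp (g t j) 2 volume ∧ Literature.Analysis.FunctionSpaces.Torus.HasWeakPartialDeriv j (u t) (g t j)) → Filter.limsup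 (fun T : ℝ => ((ENNReal.ofReal T)⁻¹ * ∫⁻ t in Set.Ioc (0 : ℝ) T, (∫⁻ x, ∑ j : Fin 3, ‖g t j x‖ₑ ^ 2))) Filter.atTop ≤ ENNReal.ofReal L → ∀ δ : ℝ, 0 < δ → δ ≤ δ₀ → Filter.limsup (fun T : ℝ => ((ENNReal.ofReal T)⁻¹ * ∫⁻ t in Set.Ioc (0 : ℝ) T, (∫⁻ x in {x : UnitAddTorus (Fin 3) | (‖x 1‖ < δ ∨ ‖x 1 - ((1 / 2 : ℝ) : UnitAddCircle)‖ < δ ∨ ‖x 0‖ < δ ∨ ‖x 0 - ((1 / 2 : ℝ) : UnitAddCircle)‖ < δ) ∧ ‖x 2‖ < δ}, ∑ i : Fin 3, ‖g t i x i‖ₑ ^ 2))) Filter.atTop ≤ ENNReal.ofReal (K * (1 + Real.log (δ₀ / δ)) * δ ^ 2)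

/-- item stmt-AnomalousDissipation-29898 · crux · rank 3 · SPLIT (gen 1) into LogRoughStrainRougheningTG, LogTameStrainRougheningTG, SkeletonCarlesonLinkTG, WitnessDissipationBridgeLinkTG + glue RoughStrainRougheningGlueTG · direct attempts still welcome (low priority) · by planner
why it might fail: Exactly if a QUIET SINGULAR world — bounded tube enstrophy with density ≍ dist(·,skeleton)⁻¹ (√r-conical separatrix edges or Hölder-½ stagnation corners) — is realised by the Cesàro statistics of K-symmetric Leray–Hopf spin-ups uniformly in ν; no known tool excludes it.
sources: Kato1984, ChildressKerswellGilbert2001, MajdaBertozzi2002, run/shared/lean/pub/decomp-ad/census/TKR-v1.md, run/shared/lean/pub/decomp-ad/census/TR2P-v1.md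
[crux] C₃♯ GENERIC BRANCH = the NEW DECLARED RESIDUAL (refines 2A:26826 and 25779 by the strain
axis): SobolevRougheningTG → SkeletonVarianceLawTG → P₀ (symmetric Leray–Hopf existence with
witnesses, inlined) → ¬W → RootDecompCycle2A.SpinUpRougheningTG, where ¬W (W = SkeletonStrainTameTG
«quiet ⇒ tame», inlined; filed as an aside after birth) = «QUIET SINGULAR WORLDS EXIST along a
sequence»: some level L such that for all K δ₀ ν₀ there are ν < ν₀ and a K-symmetric Leray–Hopf
spin-up from rest, quiet at level L (total mean witness enstrophy ≤ L), loading the skeleton tube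
with Ŝ_δ > Kδ² at some δ ≤ δ₀ — literally the failure object of 26826. KERNEL-WEAKER than 26826
(`roughBranch_of_window`, writer sketch `rough_of_window`) and EXACT given C₁♯ + P₀ P₁ P₂
(`window_iff_rough_of_supports`); UNDECIDED, BARRIER-adjacent, IDEA-NEEDED (natural proof = prove
W), INSTRUMENTABLE (census T-KR6 Q1: m(S_δ)/δ² at δ = 2⁻⁴ vs ν at bounded total enstrophy — W
predicts ν-flat, ¬W growth ≳ ×2 per halving). [deps: SkeletonVarianceLawTG, SobolevRougheningTG]
[difficulty: open-problem] -/
@[route_item "route-AnomalousDissipation-StrainDichotomy", crux]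
def RoughStrainRougheningTG : Prop :=
  SobolevRougheningTG → SkeletonVarianceLawTG → (∀ f : UnitAddTorus (Fin 3) → EuclideanSpace ℝ (Fin 3), f = (fun x => !₂[(fourier 1 (x 0) : ℂ).im * (fourier 1 (x 1) : ℂ).re * (fourier 1 (x 2) : ℂ).re, -((fourier 1 (x 0) : ℂ).re * (fourier 1 (x 1) : ℂ).im * (fourier 1 (x 2) : ℂ).re), (0 : ℝ)]) → ∀ ν : ℝ, 0 < ν → ∃ u : ℝ → UnitAddTorus (Fin 3) → EuclideanSpace ℝ (Fin 3), Literature.Analysis.FluidPDE.Torus.IsGlobalLerayHopf ν (fun _ => f) 0 u ∧ (∀ (t : ℝ) (i j : Fin 3) (x : UnitAddTorus (Fin 3)), u t (Function.update x i (-x i)) j = if j = i then -(u t x j) else u t x j) ∧ ∃ g : ℝ → Fin 3 → UnitAddTorus (Fin 3) → EuclideanSpace ℝ (Fin 3), (∀ j : Fin 3, Measurable (Function.uncurry fun t x => g t j x)) ∧ (∀ᵐ t : ℝ, 0 < t → ∀ j : Fin 3, MemLp (g t j) 2 volume ∧ Literature.Analysis.FunctionSpaces.Torus.HasWeakPartialDeriv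 j (u t) (g t j))) → ¬ (∀ f : UnitAddTorus (Fin 3) → EuclideanSpace ℝ (Fin 3), f = (fun x => !₂[(fourier 1 (x 0) : ℂ).im * (fourier 1 (x 1) : ℂ).re * (fourier 1 (x 2) : ℂ).re, -((fourier 1 (x 0) : ℂ).re * (fourier 1 (x 1) : ℂ).im * (fourier 1 (x 2) : ℂ).re), (0 : ℝ)]) → ∀ L : ℝ, ∃ K δ₀ ν₀ : ℝ, 0 < δ₀ ∧ 0 < ν₀ ∧ ∀ ν : ℝ, 0 < ν → ν < ν₀ → ∀ u : ℝ → UnitAddTorus (Fin 3) → EuclideanSpace ℝ (Fin 3), Literature.Analysis.FluidPDE.Torus.IsGlobalLerayHopf ν (fun _ => f) 0 u → (∀ (t : ℝ) (i j : Fin 3) (x : UnitAddTorus (Fin 3)), u t (Function.update x i (-x i)) j = if j = i then -(u t x j) else u t x j) → ∀ g : ℝ → Fin 3 → UnitAddTorus (Fin 3) → EuclideanSpace ℝ (Fin 3), (∀ᵐ t : ℝ, 0 < t → ∀ j : Fin 3, MemLp (g t j) 2 volume ∧ Literature.Analysis.FunctionSpaces.Torus.HasWeakPartialDeriv j (u t)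 (g t j)) → Filter.limsup (fun T : ℝ => ((ENNReal.ofReal T)⁻¹ * ∫⁻ t in Set.Ioc (0 : ℝ) T, (∫⁻ x, ∑ j : Fin 3, ‖g t j x‖ₑ ^ 2))) Filter.atTop ≤ ENNReal.ofReal L → ∀ δ : ℝ, 0 < δ → δ ≤ δ₀ → Filter.limsup (fun T : ℝ => ((ENNReal.ofReal T)⁻¹ * ∫⁻ t in Set.Ioc (0 : ℝ) T, (∫⁻ x in {x : UnitAddTorus (Fin 3) | (‖x 1‖ < δ ∨ ‖x 1 - ((1 / 2 : ℝ) : UnitAddCircle)‖ < δ ∨ ‖x 0‖ < δ ∨ ‖x 0 - ((1 / 2 : ℝ) : UnitAddCircle)‖ < δ) ∧ ‖x 2‖ < δ}, ∑ i : Fin 3, ‖g t i x i‖ₑ ^ 2))) Filter.atTop ≤ ENNReal.ofReal (K * δ ^ 2)) → Summit.AnomalousDissipation.AnomalousDissipation.Theses.RootDecompCycle2A.SpinUpRougheningTG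

-- parent: RoughStrainRougheningTG · child (gen 1)
/--     item stmt-AnomalousDissipation-30706 · crux · rank 301 · open
    parent: RoughStrainRougheningTG · by planner
    why it might fail: A near-Lipschitz quiet world (strain density ≍ log^{1+ε}(1/r) off the skeleton, summable box variances) pays the Kelvin torque 4/π with bounded enstrophy; the single-loop time-averaged count is certified spent at log (superLogWorld_cert): needs a multi-loop or dynamical input.
    sources: DoeringFoias2002, Frisch1995, run/shared/lean/pub/decomp-ad/decomp-ad-lens-2/HarmonicStrain_NODE.md, run/shared/lean/pub/decomp-ad/decomp-ad-census-1/TKR-v1.md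
[crux · DECLARED RESIDUAL · WEAKER than 29898 by logRough_of_rough] in a world whose quiet
K-symmetric Taylor–Green Leray–Hopf solutions have super-logarithmic skeleton strain density
(¬W_log), the spin-up roughens (R1), given Sobolev roughening, the skeleton variance law and
K-symmetric existence. NEW DECLARED RESIDUAL of StrainDichotomy (replaces 29898 as the open residual
once the tribunal reads the split; kernel 29898 → C₃♭ via logTame_of_tame; C₃♭ ∧ T_log ∧ P₁ ∧ P₂ →
29898 = the split glue, excluded middle on W_log). Tags (crit-1 g2): DECLARED RESIDUAL · WEAKER
(kernel; ≡ C₃♯ mod true P₁P₂+T_log) · NECESSARY (G2 literal) · UNDECIDED(T-KR7) · IDEA-NEEDED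
(dynamical input; multi-loop coupling not excluded) · BARRIER-ADJACENT. -/
@[route_item "route-AnomalousDissipation-StrainDichotomy"]
def LogRoughStrainRougheningTG : Prop :=
  SobolevRougheningTG → SkeletonVarianceLawTG → SymmetricLerayHopfTG → ¬ SkeletonStrainLogTameTG → Summit.AnomalousDissipation.AnomalousDissipation.Theses.RootDecompCycle2A.SpinUpRougheningTG

-- parent: RoughStrainRougheningTG · child (gen 1)
/--     item stmt-AnomalousDissipation-30707 · support · rank 302 · open
    parent: RoughStrainRougheningTG · by planner
    sources: run/shared/lean/pub/decomp-ad/decomp-ad-lens-2/HarmonicStrain.lean, Stein1970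
[support · PROVED in node file: logTameStrainRoughening_holds, harmonic count] the skeleton variance
law, K-symmetric existence, the dyadic variance-Carleson bound and the witness→dissipation bridge
force R1 in every LOG-TAME world. PROVED 0 sorry in HOME/decomp-ad-lens-2/HarmonicStrain.lean
(logTameStrainRoughening_holds, harmonic count Σ1/(k+1) = ∞ vs bounded Carleson side; crit-1 g2
re-derived by hand 07:56:32Z); Theorems port file split6/StrainDichotomyLogTame_port.lean farm-clean
(spinUp_of_logTame) — port BY NAME after this edit. -/
@[route_item "route-AnomalousDissipation-StrainDichotomy"]
def LogTameStrainRougheningTG : Prop :=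
  SkeletonVarianceLawTG → SymmetricLerayHopfTG → SkeletonCarlesonTG → WitnessDissipationBridgeTG → SkeletonStrainLogTameTG → Summit.AnomalousDissipation.AnomalousDissipation.Theses.RootDecompCycle2A.SpinUpRougheningTG

-- parent: RoughStrainRougheningTG · child (gen 1)
/--     item stmt-AnomalousDissipation-30708 · support · rank 303 · open
    parent: RoughStrainRougheningTG · by planner
    sources: Stein1970
[support · BY-NAME LINK := SkeletonCarlesonTG (item 29986, P₁, TEXTBOOK; this route) — listed as a
split child only so that the generated glue C₃♭ → T_log → P₁ → P₂ → C₃♯ is provable (the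
2-antecedent glue is not); closes by `id` the moment 29986 lands; counted once.] -/
@[route_item "route-AnomalousDissipation-StrainDichotomy"]
def SkeletonCarlesonLinkTG : Prop :=
  SkeletonCarlesonTG

-- parent: RoughStrainRougheningTG · child (gen 1)
/--     item stmt-AnomalousDissipation-30709 · support · rank 304 · open
    parent: RoughStrainRougheningTG · by planner
    sources: DoeringFoias2002
[support · BY-NAME LINK := WitnessDissipationBridgeTG (item 29987, P₂; this route) — split child for
the glue only; closes by `id` once 29987 lands; counted once.] -/
@[route_item "route-AnomalousDissipation-StrainDichotomy"]
def WitnessDissipationBridgeLinkTG : Prop :=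
  WitnessDissipationBridgeTG

-- parent: RoughStrainRougheningTG · glue (gen 1)
/--     item stmt-AnomalousDissipation-30710 · support · rank 305 · open
    parent: RoughStrainRougheningTG · GLUE: children ⟹ parent · by planner
LogRoughStrainRougheningTG → LogTameStrainRougheningTG → SkeletonCarlesonLinkTG →
WitnessDissipationBridgeLinkTG → RoughStrainRougheningTG -/
@[route_item "route-AnomalousDissipation-StrainDichotomy"]
def RoughStrainRougheningGlueTG : Prop :=
  LogRoughStrainRougheningTG → LogTameStrainRougheningTG → SkeletonCarlesonLinkTG → WitnessDissipationBridgeLinkTG → RoughStrainRougheningTG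

/-- item stmt-AnomalousDissipation-29899 · support · rank 9 · open · by planner
why it might fail: It cannot in substance: excluded middle on W + the node's proved tame branch; the three supports are existence / fieldwise real analysis / Plancherel bookkeeping (sizes M, M–L, S–M).
sources: run/shared/lean/pub/decomp-ad/decomp-ad-lens-2/StrainDichotomy.lean, Stein1970, FeffermanStein1972, Galdi2000, Temam1977
[support] THE DICHOTOMY'S LOCAL ASSEMBLY (binder of `closes`; = lens kernel `window_of_split5` with
the toolkit as separately filed supports): SkeletonVarianceLawTG → RoughStrainRougheningTG →
RootDecompCycle2A.OnsagerWindowTG. THEOREM-GRADE (L in Lean), ATTACKABLE NOW: by excluded middle on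
W it follows by pure logic (writer sketch `window_of_pieces`, 0 sorry) from the three supports P₀
SymmetricLerayHopfTG (M), P₁ SkeletonCarlesonTG (M on paper / L in Lean), P₂
WitnessDissipationBridgeTG (S–M) and the SPECIAL BRANCH TameStrainRougheningTG := C₁♯ → P₀ → P₁ → P₂
→ W → R1, PROVED in the node file (`tameStrainRoughening_holds`, ≈175 lines, 0 sorry; port to
Theorems/) — all four filed on this route after birth (supports rank 9; W and the BC5 plan-only rung
SteadyVarianceLawTG as asides). KERNEL-WEAKER than 26826 (writer sketch `window_of_window`). [deps:
SkeletonVarianceLawTG, RoughStrainRougheningTG] [difficulty: L] -/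
@[route_item "route-AnomalousDissipation-StrainDichotomy", crux]
def StrainDichotomyWindowTG : Prop :=
  SkeletonVarianceLawTG → RoughStrainRougheningTG → Summit.AnomalousDissipation.AnomalousDissipation.Theses.RootDecompCycle2A.OnsagerWindowTG

/-- item stmt-AnomalousDissipation-29901 · assembly · rank 1 · open · by planner
sources: run/shared/lean/pub/decomp-ad/decomp-ad-lens-2/StrainDichotomy.lean
[assembly] SobolevRougheningTG → RestMeanCeilingTG → SkeletonVarianceLawTG → RoughStrainRougheningTG
→ StrainDichotomyWindowTG → RougheningRateUpgradeTG → the zeroth law. -/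
@[route_item "route-AnomalousDissipation-StrainDichotomy"]
def Assembly : Prop :=
  SobolevRougheningTG → RestMeanCeilingTG → SkeletonVarianceLawTG → RoughStrainRougheningTG → StrainDichotomyWindowTG → RougheningRateUpgradeTG → _root_.AnomalousDissipation

/-! D-0027 §2.1 — DECIDING THEOREM (planner-authored via `route open/edit --closes-file`; by planner-decomp-ad-writer-1-g4-0 2026-08-30T07:06:42Z):
its hypotheses are this route's items and its conclusion the sub-problem Statement (glue_lint), and it elaborates with this file. -/

@[closes "route-AnomalousDissipation-StrainDichotomy"] theorem closes (hS : SobolevRougheningTG) (hC : RestMeanCeilingTG) (hL : SkeletonVarianceLawTG) (hR : RoughStrainRougheningTG)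
    (hK : StrainDichotomyWindowTG) (hU : RougheningRateUpgradeTG) : _root_.AnomalousDissipation :=
  Summit.AnomalousDissipation.AnomalousDissipation.Theses.RootDecompCycle2A.closes
    (fun f hf => by
      subst hf
      exact ⟨Summit.AnomalousDissipation.AnomalousDissipation.Theorems.TaylorGreenLoudGalerkinStates.Negative.isSmooth_tgForce,
        Summit.AnomalousDissipation.AnomalousDissipation.Theorems.TaylorGreenLoudGalerkinStates.Negative.isDivFree_tgForce,
        Summit.AnomalousDissipation.AnomalousDissipation.Theorems.TaylorGreenLoudGalerkinStates.Negative.hasZeroMean_tgForce⟩)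
    hC (hK hL hR hS) hU

end Summit.AnomalousDissipation.AnomalousDissipation.Theses.StrainDichotomy
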